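import Literature.NumberTheory.GaloisRepresentations.InducedGaloisRep
import Literature.NumberTheory.GaloisRepresentations.FramedRepBlockSum
import Literature.RepresentationTheory.Semisimple.SubrepresentationEquiv
import HarnessLib

/-!
# Mackey's irreducibility criterion for the induction of a character (matrix form)
(helper for the MONOMIAL region of crux stmt-Langlands-14329 `IrreducibleOffSector`, line `Sketch`,
lead c4; pure Galois-side algebra, no automorphic input)

For a finite Galois extension `F/K` of fields of characteristic `0` of degree `d`, a field of
coefficients `A` and a continuous character `ψ : Γ_F → GL_1(A)`, the induced representation
`Ind_{Γ_F}^{Γ_K} ψ : Γ_K → GL_d(A)` (`FramedGaloisRep.induce`, matrix form on the basis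
`r_1 e, …, r_d e` indexed by the chosen coset representatives `r_i` of `Γ_K / res(Γ_F)`) is
IRREDUCIBLE as soon as the conjugate characters `ψ^{r_i⁻¹}` (`FramedGaloisRep.outerConj`) are
pairwise distinct (`isIrreducible_induce_of_outerConj_ne`).  This is the character case of
Mackey's criterion (Serre, *Linear representations of finite groups*, §7.4, Cor. of Prop. 23),
proved here by the elementary argument valid for any group and any field of coefficients (no
semisimplicity, no Frobenius reciprocity): on `res(Γ_F)` the matrices `Ind(ψ)(res σ)` are
DIAGONAL with entries `ψ^{r_i⁻¹}(σ)` (`induce_absGaloisRestrict_coe`), so a non-zero vector of a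
stable subspace `W` can be cut down, by the operators `Ind(ψ)(res σ) - ψ^{r_j⁻¹}(σ)` with `σ`
separating `ψ^{r_{i₀}⁻¹}` from `ψ^{r_j⁻¹}`, to a non-zero multiple of one basis vector `e_{i₀}`;
and `Ind(ψ)(r_k r_{i₀}⁻¹) e_{i₀} = e_k` (the matrices of `Ind(ψ)` are monomial), so `W` contains
every basis vector.  Also: relabelling a framed representation along `Fin m ≃ Fin n` preserves
irreducibility (`isIrreducible_reindex`, used to cast `Ind ψ` from rank `d * 1` to rank `n`).

References: J.-P. Serre, *Linear representations of finite groups*, GTM 42 (1977), §3.3 (matrix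
form of `Ind`), §7.3 Prop. 22, §7.4 Cor. [SerreLinearRepresentations1977].
-/

noncomputable section

set_option linter.dupNamespace false

open scoped Matrix
open Field
open Literature.NumberTheory.GaloisRepresentations

namespace Summit.Langlands.Langlands.Theorems.IrreducibleOffSector

section MackeyOne

variable (K : Type) {F : Type} [Field K] [Field F] [Algebra K F] [CharZero K]
  [FiniteDimensional K F] [IsGalois K F] [CharZero F]
  {A : Type*} [Field A] [TopologicalSpace A] [IsTopologicalRing A] {d : ℕ}

omit [IsTopologicalRing A] in
/-- **`Ind(ψ)(res σ)` is diagonal** with entries the conjugate character values: for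
`ψ : Γ_F → GL_1(A)` and `σ ∈ Γ_F`,
`Ind(ψ)(res σ) · v = (ψ^{r_{i(x)}⁻¹}(σ) v_x)_x`, `i(x)` the block of the index `x`.
(Serre §7.3 Prop. 22: `Res Ind ψ = ⊕_i ψ^{r_i⁻¹}`.) [cite: SerreLinearRepresentations1977, §7.3 Prop. 22] -/
theorem induce_absGaloisRestrict_mulVec (hd : Module.finrank K F = d) (ψ : FramedGaloisRep F A 1)
    (σ : absoluteGaloisGroup F) (v : Fin (d * 1) → A) :
    ((ψ.induce K hd (absGaloisRestrict K F σ) : GL (Fin (d * 1)) A) :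
        Matrix (Fin (d * 1)) (Fin (d * 1)) A) *ᵥ v =
      fun x => ((ψ.outerConj (absGaloisCosetRep K F hd (finProdFinEquiv.symm x).1)⁻¹ σ :
        GL (Fin 1) A) : Matrix (Fin 1) (Fin 1) A) 0 0 * v x := by
  rw [FramedGaloisRep.induce_absGaloisRestrict_coe K hd ψ σ]
  have hdiag : Matrix.reindex finProdFinEquiv finProdFinEquiv
      (Matrix.comp (Fin d) (Fin d) (Fin 1) (Fin 1) A
        (Matrix.diagonal fun i =>
          ((ψ.outerConj (absGaloisCosetRep K F hd i)⁻¹ σ : GL (Fin 1) A) :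
            Matrix (Fin 1) (Fin 1) A))) =
      Matrix.diagonal fun x => ((ψ.outerConj (absGaloisCosetRep K F hd
        (finProdFinEquiv.symm x).1)⁻¹ σ : GL (Fin 1) A) : Matrix (Fin 1) (Fin 1) A) 0 0 := by
    ext x y
    rw [Matrix.reindex_apply, Matrix.submatrix_apply, Matrix.comp_apply, Matrix.diagonal_apply,
      Matrix.diagonal_apply]
    by_cases hxy : x = y
    · subst hxy
      rw [if_pos rfl, if_pos rfl, Subsingleton.elim (finProdFinEquiv.symm x).2 0]
    · have h1 : (finProdFinEquiv.symm x).1 ≠ (finProdFinEquiv.symm y).1 := by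
        intro h
        apply hxy
        apply finProdFinEquiv.symm.injective
        exact Prod.ext h (Subsingleton.elim _ _)
      rw [if_neg h1, if_neg hxy, Matrix.zero_apply]
  rw [hdiag]
  funext x
  rw [Matrix.mulVec_diagonal]

omit [IsGalois K F] [CharZero F] [IsTopologicalRing A] in
/-- **The matrices of `Ind(ψ)` are monomial**: `Ind(ψ)(r_k r_i⁻¹)` maps the basis vector `e_i` to
`e_k` (block `(j, i)` of `Ind(ψ)(g)` is `ψ̇(r_j⁻¹ g r_i)`, non-zero only for the coset `j` of
`g r_i`; here `g r_i = r_k`). (Serre §3.3, proof of Thm. 12.) [cite: SerreLinearRepresentations1977, §3.3 Thm. 12 (proof)] -/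
theorem induce_mulVec_single (hd : Module.finrank K F = d) (ψ : FramedGaloisRep F A 1)
    (i k : Fin d) :
    ((ψ.induce K hd (absGaloisCosetRep K F hd k * (absGaloisCosetRep K F hd i)⁻¹) :
        GL (Fin (d * 1)) A) : Matrix (Fin (d * 1)) (Fin (d * 1)) A) *ᵥ
        Pi.single (finProdFinEquiv (i, 0)) 1 =
      Pi.single (finProdFinEquiv (k, 0)) 1 := by
  classical
  rw [Matrix.mulVec_single_one]
  funext x
  rw [Matrix.col_apply, FramedGaloisRep.induce_apply_coe_apply, Equiv.symm_apply_apply]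
  set j := (finProdFinEquiv.symm x).1 with hj
  have hg : (absGaloisCosetRep K F hd j)⁻¹ *
      (absGaloisCosetRep K F hd k * (absGaloisCosetRep K F hd i)⁻¹) * absGaloisCosetRep K F hd i =
      (absGaloisCosetRep K F hd j)⁻¹ * 1 * absGaloisCosetRep K F hd k := by group
  rw [hg]
  by_cases hjk : j = k
  · have hx : x = finProdFinEquiv (k, 0) := by
      rw [← hjk, hj, show ((finProdFinEquiv.symm x).1, (0 : Fin 1)) = finProdFinEquiv.symm x from
        Prod.ext rfl (Subsingleton.elim _ _), Equiv.apply_symm_apply]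
    rw [hjk, mul_one, inv_mul_cancel, ← (absGaloisRestrict K F).toMonoidHom.map_one,
      dotExtend_apply_map (absGaloisRestrict_injective K F), hx, Pi.single_eq_same]
    simp
  · have hx : x ≠ finProdFinEquiv (k, 0) := by
      intro hx
      apply hjk
      rw [hj, hx, Equiv.symm_apply_apply]
    rw [Pi.single_eq_of_ne hx, dotExtend_of_not_mem]
    · rfl
    · intro hmem
      apply hjk
      exact (absGaloisCosetRep_bijective K F hd).1
        ((inv_mul_mul_mem_range_iff _ _ 1 j k).1 hmem |>.trans (by rw [one_mul]))

omit K in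
/-- In rank `d * 1`, every index is the head of its block: `x = e((e⁻¹ x).1, 0)`. [folklore] -/
theorem finProdFinEquiv_fst_zero (x : Fin (d * 1)) :
    finProdFinEquiv ((finProdFinEquiv.symm x).1, (0 : Fin 1)) = x := by
  rw [show ((finProdFinEquiv.symm x).1, (0 : Fin 1)) = finProdFinEquiv.symm x from
    Prod.ext rfl (Subsingleton.elim _ _), Equiv.apply_symm_apply]

end MackeyOne

section Main

/-- **Mackey's criterion, character case: `Ind_{Γ_F}^{Γ_K} ψ` is irreducible when the conjugates
`ψ^{r_i⁻¹}` are pairwise distinct.**  Let `F/K` be a finite Galois extension of fields of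
characteristic `0` of degree `d`, `A` a field and `ψ : Γ_F → GL_1(A)` a continuous character such
that for all `i ≠ j` some `σ ∈ Γ_F` has `ψ^{r_i⁻¹}(σ) ≠ ψ^{r_j⁻¹}(σ)` (`r_i` the chosen coset
representatives `absGaloisCosetRep`; `FramedGaloisRep.outerConj`).  Then the matrix representation
`Ind(ψ) = ψ.induce K hd : Γ_K → GL_d(A)` is irreducible.  Proof (elementary, any field `A`): a
non-zero vector `w` of a `Γ_K`-stable subspace `W` has a non-zero coordinate `x₀` (block `i₀`);
applying `∏_{j ≠ i₀} (Ind(ψ)(res σ_j) - ψ^{r_j⁻¹}(σ_j))` with `σ_j` separating `i₀` from `j`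
(diagonal operators, `induce_absGaloisRestrict_mulVec`) leaves a NON-ZERO multiple of `e_{x₀}` in
`W`; then `Ind(ψ)(r_k r_{i₀}⁻¹) e_{i₀} = e_k ∈ W` for every `k` (`induce_mulVec_single`), so `W`
is everything.  Serre, *Linear representations of finite groups*, §7.4 Cor. (Mackey's
irreducibility criterion), here for `H` normal and `ρ = ψ` a character.
[cite: SerreLinearRepresentations1977, §7.3 Prop. 22] -/
theorem isIrreducible_induce_of_outerConj_ne (K : Type) {F : Type} [Field K] [Field F]
    [Algebra K F] [CharZero K] [FiniteDimensional K F] [IsGalois K F] [CharZero F]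
    {A : Type*} [Field A] [TopologicalSpace A] [IsTopologicalRing A] {d : ℕ}
    (hd : Module.finrank K F = d) (ψ : FramedGaloisRep F A 1)
    (hreg : ∀ i j : Fin d, i ≠ j → ∃ σ : absoluteGaloisGroup F,
      ψ.outerConj (absGaloisCosetRep K F hd i)⁻¹ σ ≠ ψ.outerConj (absGaloisCosetRep K F hd j)⁻¹ σ) :
    (ψ.induce K hd).toGaloisRep.IsIrreducible := by
  classical
  -- the conjugate character values `c i σ = ψ^{r_i⁻¹}(σ)` and their separation
  let c : Fin d → absoluteGaloisGroup F → A := fun i σ =>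
    ((ψ.outerConj (absGaloisCosetRep K F hd i)⁻¹ σ : GL (Fin 1) A) : Matrix (Fin 1) (Fin 1) A) 0 0
  have hreg' : ∀ i j : Fin d, i ≠ j → ∃ σ : absoluteGaloisGroup F, c i σ ≠ c j σ := by
    intro i j hij
    obtain ⟨σ, hσ⟩ := hreg i j hij
    refine ⟨σ, fun h => hσ ?_⟩
    ext a b
    rw [Subsingleton.elim a 0, Subsingleton.elim b 0]
    exact h
  -- notation: the block of an index, the basis vectors
  let blk : Fin (d * 1) → Fin d := fun x => (finProdFinEquiv.symm x).1
  let bv : Fin d → (Fin (d * 1) → A) := fun k => Pi.single (finProdFinEquiv (k, 0)) 1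
  have hblk_inj : ∀ x y : Fin (d * 1), blk x = blk y → x = y := fun x y h => by
    rw [← finProdFinEquiv_fst_zero x, ← finProdFinEquiv_fst_zero y]
    exact congrArg _ (Prod.ext h rfl)
  have hbv : ∀ x : Fin (d * 1), bv (blk x) = Pi.single x 1 := fun x => by
    show (Pi.single (finProdFinEquiv ((finProdFinEquiv.symm x).1, 0)) 1 : Fin (d * 1) → A) =
      Pi.single x 1
    rw [finProdFinEquiv_fst_zero]
  -- the action on vectors
  have hact : ∀ (g : absoluteGaloisGroup K) (v : Fin (d * 1) → A),
      (ψ.induce K hd).toGaloisRep.toRepresentation g v =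
        ((ψ.induce K hd g : GL (Fin (d * 1)) A) : Matrix (Fin (d * 1)) (Fin (d * 1)) A) *ᵥ v :=
    fun g v => rfl
  -- `0 < d`
  have hdpos : 0 < d := hd ▸ Module.finrank_pos
  -- Step 1: a stable subspace containing a vector with a non-zero coordinate `x₀` contains the
  -- basis vector `e_{x₀}`
  have step1 : ∀ (W : Subrepresentation (ψ.induce K hd).toGaloisRep.toRepresentation)
      (w : Fin (d * 1) → A) (x₀ : Fin (d * 1)), w ∈ W.toSubmodule → w x₀ ≠ 0 →
        bv (blk x₀) ∈ W.toSubmodule := by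
    intro W w x₀ hw hx₀
    -- cut `w` down to its `x₀`-coordinate, one foreign block at a time
    have hcut : ∀ S : Finset (Fin d), blk x₀ ∉ S →
        ∃ w' ∈ W.toSubmodule, w' x₀ ≠ 0 ∧ ∀ x, blk x ∈ S → w' x = 0 := by
      intro S
      induction S using Finset.induction_on with
      | empty => exact fun _ => ⟨w, hw, hx₀, fun x hx => absurd hx (Finset.notMem_empty _)⟩
      | @insert j S hjS ih =>
        intro hx₀S
        rw [Finset.mem_insert, not_or] at hx₀S
        obtain ⟨w', hw', hw'x₀, hw'S⟩ := ih hx₀S.2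
        obtain ⟨σ, hσ⟩ := hreg' (blk x₀) j hx₀S.1
        -- `w'' = Ind(ψ)(res σ) w' - ψ^{r_j⁻¹}(σ) • w'`
        refine ⟨(ψ.induce K hd).toGaloisRep.toRepresentation (absGaloisRestrict K F σ) w' -
            c j σ • w', ?_, ?_, ?_⟩
        · exact W.toSubmodule.sub_mem (W.apply_mem_toSubmodule _ hw')
            (W.toSubmodule.smul_mem _ hw')
        · rw [Pi.sub_apply, Pi.smul_apply, hact, induce_absGaloisRestrict_mulVec, smul_eq_mul,
            ← sub_mul]
          exact mul_ne_zero (sub_ne_zero.2 hσ) hw'x₀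
        · intro x hx
          rw [Pi.sub_apply, Pi.smul_apply, hact, induce_absGaloisRestrict_mulVec, smul_eq_mul,
            ← sub_mul]
          rcases Finset.mem_insert.1 hx with hxj | hxS
          · change (c (blk x) σ - c j σ) * w' x = 0
            rw [hxj, sub_self, zero_mul]
          · rw [hw'S x hxS, mul_zero]
    obtain ⟨w', hw', hw'x₀, hw'S⟩ := hcut (Finset.univ.erase (blk x₀)) (Finset.notMem_erase _ _)
    -- `w'` is supported at `x₀`: `w' = c • e_{x₀}`, `c = w' x₀ ≠ 0`
    obtain ⟨c, hc⟩ : ∃ c : A, c = w' x₀ := ⟨_, rfl⟩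
    have hw'eq : w' = c • bv (blk x₀) := by
      rw [hbv x₀]
      funext x
      rw [Pi.smul_apply, smul_eq_mul]
      by_cases hx : x = x₀
      · subst hx; rw [Pi.single_eq_same, mul_one, hc]
      · rw [Pi.single_eq_of_ne hx, mul_zero]
        exact hw'S x (Finset.mem_erase.2 ⟨fun h => hx (hblk_inj x x₀ h), Finset.mem_univ _⟩)
    have hc0 : c ≠ 0 := hc ▸ hw'x₀
    have h1 : c⁻¹ • w' ∈ W.toSubmodule := W.toSubmodule.smul_mem _ hw'
    rwa [hw'eq, smul_smul, inv_mul_cancel₀ hc0, one_smul] at h1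
  -- Step 2: a stable subspace containing one basis vector contains all of them
  have step2 : ∀ (W : Subrepresentation (ψ.induce K hd).toGaloisRep.toRepresentation) (i : Fin d),
      bv i ∈ W.toSubmodule → ∀ k, bv k ∈ W.toSubmodule := by
    intro W i hi k
    have := W.apply_mem_toSubmodule
      (absGaloisCosetRep K F hd k * (absGaloisCosetRep K F hd i)⁻¹) hi
    rwa [hact, induce_mulVec_single] at this
  -- Step 3: the basis vectors span
  have step3 : ∀ (W : Subrepresentation (ψ.induce K hd).toGaloisRep.toRepresentation),
      (∀ k, bv k ∈ W.toSubmodule) → W = ⊤ := by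
    intro W hW
    apply Subrepresentation.toSubmodule_injective
    change W.toSubmodule = ⊤
    rw [eq_top_iff]
    rintro v -
    rw [← Finset.univ_sum_single v]
    refine W.toSubmodule.sum_mem fun x _ => ?_
    have hx : (Pi.single x (v x) : Fin (d * 1) → A) = v x • bv (blk x) := by
      rw [hbv x, ← Pi.single_smul, smul_eq_mul, mul_one (v x)]
    rw [hx]
    exact W.toSubmodule.smul_mem _ (hW (blk x))
  -- conclusion
  haveI : Nontrivial (Subrepresentation (ψ.induce K hd).toGaloisRep.toRepresentation) := by
    refine ⟨⟨⊥, ⊤, fun h => ?_⟩⟩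
    have hmem : bv ⟨0, hdpos⟩ ∈
        (⊥ : Subrepresentation (ψ.induce K hd).toGaloisRep.toRepresentation).toSubmodule := by
      rw [h]; trivial
    have hzero : bv ⟨0, hdpos⟩ = 0 := hmem
    have := congrFun hzero (finProdFinEquiv (⟨0, hdpos⟩, 0))
    rw [Pi.zero_apply, show bv ⟨0, hdpos⟩ = Pi.single (finProdFinEquiv (⟨0, hdpos⟩, 0)) 1 from rfl,
      Pi.single_eq_same] at this
    exact one_ne_zero this
  refine ⟨fun W => ?_⟩
  by_cases hW : W = ⊥
  · exact Or.inl hW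
  · right
    -- a non-zero vector of `W`, and a non-zero coordinate of it
    have hW' : W.toSubmodule ≠ ⊥ := fun h =>
      hW (Subrepresentation.toSubmodule_injective (h.trans rfl))
    obtain ⟨w, hw, hw0⟩ := (Submodule.ne_bot_iff _).1 hW'
    obtain ⟨x₀, hx₀⟩ := Function.ne_iff.1 hw0
    exact step3 W (step2 W (blk x₀) (step1 W w x₀ hw hx₀))

end Main

section Reindex

variable {G : Type*} [Group G] [TopologicalSpace G] {A : Type*} [Field A] [TopologicalSpace A]
  [IsTopologicalRing A] {m n : ℕ}

/-- **Relabelling preserves irreducibility**: for `e : Fin m ≃ Fin n` the representation on `Aⁿ`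
underlying `ρ.reindex e` (matrices `reindex e e (ρ g)`) is equivalent to the one on `Aᵐ`
underlying `ρ`, along `v ↦ v ∘ e⁻¹` (Mathlib `LinearEquiv.funCongrLeft`,
`Matrix.submatrix_mulVec_equiv`), and irreducibility is invariant under equivalence
(`Representation.isIrreducible_of_equiv`). [folklore] -/
theorem isIrreducible_reindex (e : Fin m ≃ Fin n) (ρ : FramedRep G A m)
    (h : ρ.toContinuousRep.IsIrreducible) : (FramedRep.reindex e ρ).toContinuousRep.IsIrreducible := by
  -- the intertwining linear equivalence `v ↦ v ∘ e.symm`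
  let L : (Fin m → A) ≃ₗ[A] (Fin n → A) := LinearEquiv.funCongrLeft A A e.symm
  have hL : ∀ v : Fin m → A, L v = v ∘ e.symm := fun v => rfl
  have hE : ∀ g : G, (L : (Fin m → A) →ₗ[A] (Fin n → A)) ∘ₗ ρ.toRepresentation g =
      (FramedRep.reindex e ρ).toRepresentation g ∘ₗ (L : (Fin m → A) →ₗ[A] (Fin n → A)) := by
    intro g
    apply LinearMap.ext
    intro v
    change L (ρ.toRepresentation g v) = (FramedRep.reindex e ρ).toRepresentation g (L v)
    rw [hL, hL, FramedRep.toRepresentation_apply_apply, FramedRep.toRepresentation_apply_apply,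
      FramedRep.coe_reindex_apply, Matrix.reindex_apply, Matrix.submatrix_mulVec_equiv,
      Equiv.symm_symm, Function.comp_assoc, Equiv.symm_comp_self, Function.comp_id]
  haveI : ρ.toRepresentation.IsIrreducible := h
  exact Literature.RepresentationTheory.Semisimple.Representation.isIrreducible_of_equiv
    (Representation.Equiv.mk L hE)

end Reindex

end Summit.Langlands.Langlands.Theorems.IrreducibleOffSector

end
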